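import Literature.AnabelianGeometry.EtaleTheta.ThetaSettingOriginClauses
import HarnessLib

/-!
# [EtTh] §1: the origin clause «the cusps of `Y` are `K`-rational and split in `Y_N` over `K_N`» (additive predicate)

Mochizuki, *The étale theta function and its Frobenioid-theoretic manifestations*, Publ. RIMS **45** (2009), §1,
PRIMS PDF p. 13 l. 30–47 (printed 239): «any decomposition group of a cusp of Y^log determines, up to conjugation
by (Δ^tp_Y)^ell, a section G_K → (Π^tp_Y)^ell of the natural surjection (Π^tp_Y)^ell ↠ G_K whose restriction to
the open subgroup G_{K_N} ⊆ G_K determines an open immersion G_{K_N} ↪ (Π^tp_Y)^ell/N·(Δ^tp_Y)^ell the image of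
which is stabilized by the conjugation action of Π^tp_X. […] Thus, this image determines a Galois covering
Y_N → Y such that the resulting surjection Π^tp_Y ↠ Gal(Y_N/Y), whose kernel we denote by Π^tp_{Y_N}, …»; p. 17
«K̈ = K₂», «Ÿ = Y₂» [cite: MochizukiEtTh2009, §1 p.13]. abc-iut cell, layer L2, seat abc-iut-L2-t1 (§1 ROOT
owner); 13:00Z v-next census item C15 (GAP G-w6d069-1, abc-iut-w6-d069; drafter abc-iut-L2-t3 g4: «PREDICATE in the
origin-clause family … owner L2-t1 lineage, class (c); not a field»). CLASS (c): one ADDITIVE `Prop`-valued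
predicate on the FROZEN root `ThetaSetting` (v3), never asserted; companion of abc-iut-L2-t6's
`ThetaSetting.IsThm16Origin` (`ThetaSettingOriginClauses.lean`), whose clause R2 `Thm16Sub.GtpYNFromCusp` (HOW print
DEFINES `Y_N`) implies it (PROVED below).

* `ThetaSetting.CuspsSplitInYN D` — for every cusp `x`, every conjugate `γ • D_x` of its decomposition group
  (`ConjAct`, as in L3's `IsCuspidalDecompositionGroup`) and every `N`: `γ • D_x ∩ aug⁻¹(G_{K_N}) ≤ Π^tp_{Y_N}` («the cusps of Y are K-rational; Y_N → Y is built from a cusp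
  section over K_N»; at `N = 2`: the part of `D_y` over `G_K̈` lies in `Π^tp_Ÿ` — the cusps of `Y` SPLIT in `Ÿ`).
* `ThetaSetting.cuspsSplitInYN_of_gtpYNFromCusp` — R2 for every `N` + «decomposition groups of cusps lie in
  Π^tp_Y» (p. 13; abc-iut-w5-d111's parameter (P3) `OncePuncturedData.decomp_le_ker_toZ`) ⇒ `CuspsSplitInYN`;
  `ThetaSetting.IsThm16Origin.cuspsSplitInYN` — hence from the origin predicate + (P3).
Consumer: the cone node [IUTchII] Cor 2.4 (ii) — abc-iut-w6-d069's `cor24_ii_iii'_iff_ysplit` (p432010) reduces it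
to exactly this clause at the [EtTh] model. HONEST FRAMING: a property of the GENUINE data the typed interface
omits (the root axioms of `GtpYN` record index / Galois image / normality only); nothing asserted; [EtTh] is
refereed; nothing here bears on [IUTchIII] Cor. 3.12; typed ≠ proved.
-/

noncomputable section

namespace Literature.AnabelianGeometry.EtaleTheta

open Literature.AnabelianGeometry.SemiGraphs
open scoped Pointwise

namespace ThetaSetting

variable {p : ℕ} [Fact p.Prime] {D : ThetaSetting p}

/-- **«The cusps of `Y` are `K`-rational and split in `Y_N` over `K_N`»** (p. 13: `Y_N → Y` is the covering cut
out by «a section G_K → (Π^tp_Y)^ell» from «any decomposition group of a cusp of Y^log», restricted to `G_{K_N}`):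
for every cusp `x` of `X`, every `Π^tp_X`-conjugate of its decomposition group (= the decomposition groups of the
cusps of `Y`, a `Z`-torsor) meets `aug⁻¹(G_{K_N})` inside `Π^tp_{Y_N}`. At `N = 2` (`K̈ = K₂`, `Ÿ = Y₂`, p. 17):
the cusps of `Y` split in `Ÿ → Y` over `K̈`. [cite: MochizukiEtTh2009, §1 p.13] -/
def CuspsSplitInYN (D : ThetaSetting p) : Prop :=
  ∀ x : D.Pt, D.IsCusp x → ∀ (γ : ConjAct D.PiTemp) (N : ℕ+),
    γ • D.decomp x ⊓ (D.GKN N).comap D.aug.toMonoidHom ≤ D.GtpYN N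

/-- **R2 ⇒ C15**: if `Π^tp_{Y_N}` IS the subgroup print constructs from a cusp section (abc-iut-L6-d5's
`Thm16Sub.GtpYNFromCusp D N`, for every `N`) and decomposition groups of cusps lie in `Π^tp_Y` (p. 13), then the
cusps split in every `Y_N` over `K_N`. [cite: MochizukiEtTh2009, §1 p.13] -/
theorem cuspsSplitInYN_of_gtpYNFromCusp (hR2 : ∀ N : ℕ+, Thm16Sub.GtpYNFromCusp D N)
    (hP3 : ∀ x : D.Pt, D.IsCusp x → D.decomp x ≤ D.GtpY) : D.CuspsSplitInYN := by
  intro x hx γ N h hh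
  have hcusp : D.IsCuspidalDecompositionGroup (γ • D.decomp x) := ⟨x, hx, γ, rfl⟩
  haveI : D.GtpY.Normal := by unfold GtpY; infer_instance
  have hDcY : γ • D.decomp x ≤ D.GtpY := by
    intro z hz
    rw [Subgroup.mem_pointwise_smul_iff_inv_smul_mem] at hz
    have h1 := Subgroup.Normal.conj_mem inferInstance (γ⁻¹ • z) (hP3 x hx hz) (ConjAct.ofConjAct γ)
    rwa [← ConjAct.smul_def, smul_inv_smul] at h1
  refine ((hR2 N) _ hcusp hDcY h).mpr ⟨hDcY hh.1, hh.2, ?_⟩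
  exact Subgroup.mem_sup_left ⟨h, ⟨hh.1, hh.2⟩, rfl⟩

/-- **The origin predicate implies C15**: `IsThm16Origin D` (clause R2 for every `N`) together with «decomposition
groups of cusps lie in Π^tp_Y» (parameter (P3) of abc-iut-w5-d111's `OncePuncturedData`) gives `CuspsSplitInYN D`.
[cite: MochizukiEtTh2009, §1 p.13] -/
theorem IsThm16Origin.cuspsSplitInYN (h : D.IsThm16Origin)
    (hP3 : ∀ x : D.Pt, D.IsCusp x → D.decomp x ≤ D.GtpY) : D.CuspsSplitInYN :=
  cuspsSplitInYN_of_gtpYNFromCusp h.gtpYN_fromCusp hP3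

/-- The `N = 2` instance: the part of a cusp's decomposition group over `G_K̈ = G_{K₂}` lies in
`Π^tp_{Y₂}` («Ÿ = Y₂», p. 17). [cite: MochizukiEtTh2009, §1 p.17] -/
theorem CuspsSplitInYN.smul_decomp_inf_le_GtpYN_two (h : D.CuspsSplitInYN) {x : D.Pt} (hx : D.IsCusp x)
    (γ : ConjAct D.PiTemp) :
    γ • D.decomp x ⊓ D.GKdd.comap D.aug.toMonoidHom ≤ D.GtpYN 2 :=
  h x hx γ 2

end ThetaSetting

end Literature.AnabelianGeometry.EtaleTheta

end
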